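import Summits.HodgeConjecture.HodgeConjecture.Theorems.Ring2AbelianAllSpreadFloorCollapseHolds
import HarnessLib

/-!
# Ring 2 · AbelianAll · SPREADING axis, part XXIV — the anchored floor restricted to the MIDDLE DEGREE:
# `F_CM^mid`, a typed node BELOW the class `F_CM ≡ F_CM^prim ≡ F_CM^{prim,ev}` by a fact-free edge, closing with `HC_CM`,
# and NOT reachable by the pull-back transport that collapsed the other restrictions

research route, not a corollary; conditional on HC_CM plus one named minimal statement.
(Cell line: research route conditional on HC_CM; not a corollary; Q11.4-sentence-2 already refuted in dim ≥ 3.)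

Seat `pub-hodge-ring2-ab-spread-1` (SPREADING), generation 27. Nothing in this file is a case of the Hodge conjecture.
`HC_CM` = `Theses.RankFourFaces.CMAbelianHodge` and `HC_AV` = `Theses.PadicSemiregularLift.HodgeAbelianVarieties` occur ONLY as
explicit hypotheses / sides of equivalences; the item `Theses.RankFourFaces.CMToAbelian` (stmt-HodgeConjecture-16267) stays OPEN.
ONE new research node (`@[conjecture] def`, never asserted, a HYPOTHESIS wherever used), no named fact, no sorry.

## Why this file

Part XXIII showed that the two restrictions of the anchored floor made so far — to Lefschetz-PRIMITIVE classes (XIV) and to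
EVEN dimension `≥ 2p` (XV) — change the binder and not the strength: `F_CM ↔ F_CM^prim ↔ F_CM^{prim,ev}` fact-free, because
every rational `(p,p)` class is the pull-back `Δ^* c'` of a primitive one on `A^{2p}` and anchored data pull back along
homomorphisms (XVII §1). The SAME transport can never reach the MIDDLE degree: `ι^* c' = c` with `c' ∈ H^{dim A'}(A')` forces
`dim A' = 2p`, i.e. `c` pulled back from an abelian variety of dimension `2p` — which a general class of degree `2p < dim A` on a
simple abelian variety is not. On the other hand the tree reduces `HC_AV` to the middle degree of even-dimensional abelian
varieties (part XV §2 `HC_AV_iff_forall_middleDegree`, BFNP Lemma 48 inside abelian varieties: `c ↦ c ⊠ [pt]` on `A × B` — an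
EXTERNAL product with a positive-degree class, killed by every pull-back section, so NOT invertible along anchored data). Hence
the node
* `MiddleHodgeFailureSpreadsToCMFibre` (`F_CM^mid`): every NON-algebraic rational `(m,m)` class in the MIDDLE degree `H^{2m}(A)`,
  `m ≥ 2`, of a complex abelian variety of dimension `2m` has a CM-pointed anchored datum (part VII §A) with a CM failure —
is (§2) BELOW `F_CM` by the fact-free restriction edge `F_CM → F_CM^mid` (hence below `F_CM^prim`, `F_CM^{prim,ev}` through XXIII),
(§3) CLOSES with `HC_CM`: `HC_CM → F_CM^mid → HC_AV` with EXACTLY two hypotheses and NO named fact (XV §2 + part VII's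
`forall_cmLocus_mem_algebraicClasses_of_HC_CM_of_isCMAnchoredDatumFor`), is ON-PATH (`HC_AV → F_CM^mid` vacuously) and EXACT
(`HC_AV ↔ HC_CM ∧ F_CM^mid`), so `ModCM F_CM^mid ↔ CMToAbelian`.

## Honest column

K (kernel, fact-free) for every row. What is NOT proved and NOT claimed: the converse `F_CM^mid → F_CM` free of `HC_CM` (OPEN to
this pen; under `HC_CM` all floor nodes coincide, §3); that `F_CM^mid` is minimal ("minimal" is claimed for nothing — F-ab-4/81/96);
that `F_CM^mid` is STRICTLY smaller than `F_CM` (not claimed: no separating model is offered). What distinguishes this restriction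
from XIV/XV's, precisely: the pull-back transport of XVII §1 / XXII (`IsCMAnchoredDatumFor.comap`, `exists_primitiveLift`) preserves
the degree `2p` and therefore cannot produce the converse edge (header argument above; not a theorem of this file), whereas it DID
produce the converses for XIV/XV (XXIII). `B_min` of record is decided by the census, not here: this file only files N104-candidate
`F_CM^mid` with its K edges `N1 → N104`, `N102 → N104`, `N103 → N104` and its closing row; if the census finds no edge back, the least
typed node becomes `F_CM^mid`; if someone proves `F_CM^mid → F_CM`, the floor class simply grows by one more binder form. Parts VII,
XIV–XXIII untouched.
[cite: BrosnanFangNiePearlstein2009, §6 Lemma 48] [cite: KerrPearlstein2011, §3.1] [cite: Deligne1982HodgeCycles, Prop. 6.1 and §6]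
[cite: VoisinHodgeI2002, Thm. 6.25, Rem. 6.27 and §11.3.3] [cite: Andre1996Motifs, §1.3 (p. 12) and Lemme 6.3.1 (p. 31)]
-/

noncomputable section

set_option linter.dupNamespace false

open CategoryTheory AlgebraicGeometry
open Literature.AlgebraicGeometry Literature.AlgebraicGeometry.Motives
open Literature.AlgebraicGeometry.HodgeTheory
open Literature.AlgebraicTopology.SingularHomology (singularCohomology)
open Literature.AlgebraicGeometry.Deligne1982 (cmLocus)

namespace Summit.HodgeConjecture.HodgeConjecture.Ring2.AbelianAll

open Summit.HodgeConjecture.HodgeConjecture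
open Summit.HodgeConjecture.HodgeConjecture.Theorems
open Summit.HodgeConjecture.HodgeConjecture.Theses
open Summit.HodgeConjecture.HodgeConjecture.Theses.RankFourFaces (CMAbelianHodge CMToAbelian)
open Summit.HodgeConjecture.HodgeConjecture.Theses.PadicSemiregularLift (HodgeAbelianVarieties)

/-! ## §1 The node `F_CM^mid` -/

/-- **`F_CM^mid` — HODGE FAILURES IN THE MIDDLE DEGREE SPREAD TO A CM FIBRE** (research node; part VII's
`HodgeFailureSpreadsToCMFibre` with its binder RESTRICTED to the middle degree `H^{2m}` of abelian varieties of dimension `2m`,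
`m ≥ 2`). For every complex abelian variety `A` of dimension `2m`, `m ≥ 2`, and every rational `(m,m)` class `c ∈ H^{2m}(A(ℂ); ℂ)`
which is NOT algebraic, there are an anchored datum `(f, s, W)` for `(A, m, c)` (part VII §A) and a CM fibre `s' ∈ cmLocus f n` at
which `W` is NOT algebraic. KERNEL (this file, NO named fact): `HC_AV ↔ HC_CM ∧ F_CM^mid`; `F_CM → F_CM^mid` (hence from
`F_CM^prim`, `F_CM^{prim,ev}` through part XXIII); the converse `F_CM^mid → F_CM` is OPEN `HC_CM`-free and is NOT reachable by the
pull-back transport of parts XVII/XXII (degrees are preserved by pull-backs). OPEN; no print locator of its own; a HYPOTHESIS wherever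
used; never asserted; "minimal" not claimed (F-ab-4); "strictly smaller than `F_CM`" not claimed. First instance `dim A = 4`, `m = 2`.
[cite: BrosnanFangNiePearlstein2009, §6 Lemma 48] [cite: Deligne1982HodgeCycles, Prop. 6.1, Thm. 2.12 and Prop. 2.9]
[cite: Andre1996Motifs, Lemme 6.3.1 (p. 31)] [status: open] -/
@[conjecture] def MiddleHodgeFailureSpreadsToCMFibre : Prop :=
  ∀ (A : AbelianVariety ℂ), IsSmoothProjective A.dim A.X → ∀ (m : ℕ), 2 ≤ m → A.dim = 2 * m →
    ∀ (c : complexBetti A.X (2 * m)), IsRationalClass c → IsOfHodgeType A.dim A.X (2 * m) m m c →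
      c ∉ algebraicClasses A.X m →
        ∃ (n : ℕ) (𝒳 S : SchemeOver ℂ) (f : 𝒳 ⟶ S) (s : ComplexPoints S) (W : complexBetti 𝒳 (2 * m)),
          IsCMAnchoredDatumFor A m c f n s W ∧
            ∃ s' ∈ cmLocus f n, complexBetti.map (fiberι f s') (2 * m) W ∉ algebraicClasses (fiberOver f s') m

/-! ## §2 Edges DOWN to `F_CM^mid` (fact-free) -/

/-- **`F_CM ⟹ F_CM^mid`** (census N1 → N104), NO fact: forget that the degree is the middle one. [folklore] -/
theorem middleHodgeFailureSpreadsToCMFibre_of_hodgeFailureSpreadsToCMFibre (h : HodgeFailureSpreadsToCMFibre) :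
    MiddleHodgeFailureSpreadsToCMFibre :=
  fun A hA m _ _ c hc hpp hnc ↦ h A hA m c hc hpp hnc

/-- **`F_CM^prim ⟹ F_CM^mid`** (N102 → N104), NO fact: through part XXIII's `F_CM^prim ⟹ F_CM`. [folklore] -/
theorem middleHodgeFailureSpreadsToCMFibre_of_primitiveHodgeFailureSpreadsToCMFibre
    (h : PrimitiveHodgeFailureSpreadsToCMFibre) : MiddleHodgeFailureSpreadsToCMFibre :=
  middleHodgeFailureSpreadsToCMFibre_of_hodgeFailureSpreadsToCMFibre
    (hodgeFailureSpreadsToCMFibre_of_primitiveHodgeFailureSpreadsToCMFibre h)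

/-- **`F_CM^{prim,ev} ⟹ F_CM^mid`** (N103 → N104), NO fact: through part XXIII's `F_CM^{prim,ev} ⟹ F_CM`. [folklore] -/
theorem middleHodgeFailureSpreadsToCMFibre_of_evenPrimitiveHodgeFailureSpreadsToCMFibre
    (h : EvenPrimitiveHodgeFailureSpreadsToCMFibre) : MiddleHodgeFailureSpreadsToCMFibre :=
  middleHodgeFailureSpreadsToCMFibre_of_hodgeFailureSpreadsToCMFibre
    (hodgeFailureSpreadsToCMFibre_of_evenPrimitiveHodgeFailureSpreadsToCMFibre h)

/-! ## §3 Closing, on-path, exactness (fact-free) -/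

/-- **`HC_AV_of_HC_CM_and_middleHodgeFailureSpreadsToCMFibre` — the brief's `HC_AV_of_HC_CM_and_Bmin` with `B_min := F_CM^mid` and
EXACTLY two hypotheses**: `HC_CM → F_CM^mid → HC_AV`, NO named fact. By part XV §2 (`HC_AV_iff_forall_middleDegree`) it suffices
to treat a rational `(m,m)` class in the middle degree of an abelian variety of dimension `2m ≥ 4`; were it not algebraic, `F_CM^mid`
gives an anchored datum and a CM fibre where `W` is NOT algebraic, while `HC_CM` makes `W` algebraic at every CM fibre (part VII) —
contradiction. [cite: BrosnanFangNiePearlstein2009, §6 Lemma 48] [cite: Deligne1982HodgeCycles, §6 proof of Thm. 2.11 (pp. 71–73)]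
[cite: Milne1999, §7 p. 72 (hypothesis (H))] -/
theorem HC_AV_of_HC_CM_and_middleHodgeFailureSpreadsToCMFibre (hCM : CMAbelianHodge)
    (h : MiddleHodgeFailureSpreadsToCMFibre) : HodgeAbelianVarieties := by
  refine HC_AV_iff_forall_middleDegree.2 fun A m h2 hA c hc hpp ↦ ?_
  by_contra hnc
  have hpp' : IsOfHodgeType A.dim A.X (2 * m) m m c := by rw [hA]; exact hpp
  obtain ⟨n, 𝒳, S, f, s, W, hd, s', hs', hns'⟩ :=
    h A (AbelianVariety.isSmoothProjective_holds (A := A)) m h2 hA c hc hpp' hnc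
  exact hns' (forall_cmLocus_mem_algebraicClasses_of_HC_CM_of_isCMAnchoredDatumFor hCM hd s' hs')

/-- `F_CM^mid` closes with `HC_CM`, NO fact (LEAD grammar). [folklore] -/
theorem closesWithCM_middleHodgeFailureSpreadsToCMFibre : ClosesWithCM MiddleHodgeFailureSpreadsToCMFibre :=
  fun hCM h ↦ HC_AV_of_HC_CM_and_middleHodgeFailureSpreadsToCMFibre hCM h

/-- Hence `F_CM^mid ⟹ CMToAbelian` outright (a typed conditional TOWARD stmt-HodgeConjecture-16267, which stays OPEN). [folklore] -/
theorem cmToAbelian_of_middleHodgeFailureSpreadsToCMFibre : MiddleHodgeFailureSpreadsToCMFibre → CMToAbelian :=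
  cmToAbelian_of_closesWithCM closesWithCM_middleHodgeFailureSpreadsToCMFibre

/-- **ON-PATH with NO fact: `HC_AV ⟹ F_CM^mid`** — under `HC_AV` nothing triggers it. [folklore] -/
theorem onPathAV_middleHodgeFailureSpreadsToCMFibre : OnPathAV MiddleHodgeFailureSpreadsToCMFibre :=
  fun hAV A _ m _ _ c hc hpp hnc ↦ absurd ((hAV A).2 m c hc hpp) hnc

/-- **EXACTNESS, NO named fact: `HC_AV ↔ (HC_CM ∧ F_CM^mid)`.** [folklore] -/
theorem exactWithCM_middleHodgeFailureSpreadsToCMFibre : ExactWithCM MiddleHodgeFailureSpreadsToCMFibre :=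
  exactWithCM_iff.2 ⟨closesWithCM_middleHodgeFailureSpreadsToCMFibre, onPathAV_middleHodgeFailureSpreadsToCMFibre⟩

/-- The same, unfolded: `HC_AV ↔ (HC_CM ∧ F_CM^mid)`, NO named fact. [folklore] -/
theorem HC_AV_iff_HC_CM_and_middleHodgeFailureSpreadsToCMFibre :
    HodgeAbelianVarieties ↔ (CMAbelianHodge ∧ MiddleHodgeFailureSpreadsToCMFibre) :=
  exactWithCM_middleHodgeFailureSpreadsToCMFibre

/-- Relativised to `HC_CM`, the node IS the item: `ModCM F_CM^mid ↔ CMToAbelian`, NO named fact. [folklore] -/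
theorem modCM_middleHodgeFailureSpreadsToCMFibre_iff_cmToAbelian :
    ModCM MiddleHodgeFailureSpreadsToCMFibre ↔ CMToAbelian :=
  modCM_iff_cmToAbelian_of_exactWithCM exactWithCM_middleHodgeFailureSpreadsToCMFibre

/-- Under `HC_CM` alone (no print), `F_CM^mid ↔ HC_AV`. [folklore] -/
theorem middleHodgeFailureSpreadsToCMFibre_iff_HC_AV_of_HC_CM (hCM : CMAbelianHodge) :
    MiddleHodgeFailureSpreadsToCMFibre ↔ HodgeAbelianVarieties :=
  iff_HC_AV_of_exactWithCM_of_HC_CM exactWithCM_middleHodgeFailureSpreadsToCMFibre hCM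

/-- COLLAPSE under `HC_CM` alone (no print): `F_CM^mid ↔ F_CM`; the `HC_CM`-free converse `F_CM^mid → F_CM` is NOT claimed. [folklore] -/
theorem middleHodgeFailureSpreadsToCMFibre_iff_of_HC_CM (hCM : CMAbelianHodge) :
    MiddleHodgeFailureSpreadsToCMFibre ↔ HodgeFailureSpreadsToCMFibre :=
  (middleHodgeFailureSpreadsToCMFibre_iff_HC_AV_of_HC_CM hCM).trans (hodgeFailureSpreadsToCMFibre_iff_HC_AV_of_HC_CM hCM).symm

/-- ON-PATH from the summit, NO fact. [folklore] -/
theorem middleHodgeFailureSpreadsToCMFibre_of_hodgeConjecture (hHC : _root_.HodgeConjecture) :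
    MiddleHodgeFailureSpreadsToCMFibre :=
  of_onPathAV_of_hodgeConjecture onPathAV_middleHodgeFailureSpreadsToCMFibre hHC

/-- **The B_min ladder of the spreading axis after parts XXIII–XXIV, NO named fact**: `(F_CM ↔ F_CM^prim) ∧ (F_CM^prim ↔ F_CM^{prim,ev})`
(XXIII), `F_CM → F_CM^mid → CMToAbelian`, and `HC_AV ↔ HC_CM ∧ F_CM^mid`. The edge `F_CM^mid → F_CM` is NOT in the ladder (open).
[folklore] -/
theorem spreadFloor_middle_ladder :
    ((HodgeFailureSpreadsToCMFibre ↔ PrimitiveHodgeFailureSpreadsToCMFibre) ∧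
        (PrimitiveHodgeFailureSpreadsToCMFibre ↔ EvenPrimitiveHodgeFailureSpreadsToCMFibre)) ∧
      (HodgeFailureSpreadsToCMFibre → MiddleHodgeFailureSpreadsToCMFibre) ∧
      (MiddleHodgeFailureSpreadsToCMFibre → CMToAbelian) ∧
      (HodgeAbelianVarieties ↔ (CMAbelianHodge ∧ MiddleHodgeFailureSpreadsToCMFibre)) :=
  ⟨spreadFloor_nodes_collapse, middleHodgeFailureSpreadsToCMFibre_of_hodgeFailureSpreadsToCMFibre,
    cmToAbelian_of_middleHodgeFailureSpreadsToCMFibre, HC_AV_iff_HC_CM_and_middleHodgeFailureSpreadsToCMFibre⟩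

end Summit.HodgeConjecture.HodgeConjecture.Ring2.AbelianAll

end
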